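import Summits.AtomisticToContinuum.Crystallization.Theses.PerronTransitivity
import Literature.MathematicalPhysics.StatisticalMechanics.CrystallizationSymmetries
import Literature.MathematicalPhysics.StatisticalMechanics.BarlowStacking
import Summits.AtomisticToContinuum.Crystallization.Theorems.PerronTransitivityUniformBindingRigidityPeriodicLeast
import Summits.AtomisticToContinuum.Crystallization.Theorems.PerronTransitivityUniformBindingRigidityStackingLock
import Summits.AtomisticToContinuum.Crystallization.Theorems.PerronTransitivityUniformBindingRigidityCohesionD
import Summits.AtomisticToContinuum.Crystallization.Theorems.PerronTransitivityUniformBindingRigidityCohesionF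
import Summits.AtomisticToContinuum.Crystallization.Theorems.PerronTransitivityUniformBindingRigidityCohesionH
import Summits.AtomisticToContinuum.Crystallization.Theorems.PerronTransitivityUniformBindingRigidityCohesionO
import Summits.AtomisticToContinuum.Crystallization.Theorems.PerronTransitivityUniformBindingRigidityCohesionP
import Summits.AtomisticToContinuum.Crystallization.Theorems.PerronTransitivityUniformBindingRigidityCohesionS

/-!
# Birth skeleton, rev 8 — crux `PerronTransitivity.UniformBindingRigidity` (stmt-AtomisticToContinuum-15099)

Rev 8 (lead c3, wave 2 integrated): `stub_sepSixteen` LANDED (p174002, `Theorems/…CohesionS.lean`, worker W3; credited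
truncation, margins `2.82 / 1.59 / 0.83`) and is now the derived `sepSixteen`; with it landed `sep_of_quarter_sixteen`
(`1/4 → 16/25` composite) and `local_sixteen_of_finiteCert_credit` (FINCERT(16/25, 6) ⇒ `stub_localHalfSpaceCert` verbatim).
Open stubs: `stub_localHalfSpaceCert` (LOCAL at `16/25`, radius `6`) and `stub_barlowChart`.  The single-site separation
ladder ends here (volume-count fixed point ≈ 0.646; two-site union-volume and fully smeared tails would add < 0.02).
Rev 7 (lead c3, wave 1 integrated): `stub_sepThirtyOne` LANDED (p173514, `Theorems/…CohesionP.lean`, worker W1) and is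
now the derived `sepThirtyOne`; the CREDITED sharp tail landed (p173665, `…CohesionQ.lean`, worker W2: layer-cake offset
`m = #near + 1`, per-near-point allowance `1/12 − R⁻⁶/6`) together with the reduction instances at `31/50`
(p173529 `…CohesionR.lean`, and `local_thirtyOne_of_finiteCert_credit` in Q).  With the credit the single-site
bootstrap runs one more rung: new registered stub `stub_sepSixteen` (`31/50 → 16/25`, provable now from
`sum_near_sub_creditTail_le_tsum`), and `stub_localHalfSpaceCert` is re-posed at separation `16/25` (competitor
density `≤ 1/vol(B_{8/25}) ≈ 7.3`).  `16/25` is the end of the single-site ladder (fixed point ≈ 0.646 with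
volume counts; the near COUNT `(2R/m+1)³` is then the wall).
Rev 6 (lead c3, 2026-08-17): the cohesion stub is cut once more along the separation ladder.  New registered
stub `stub_sepThirtyOne` — the bootstrap rung `23/40 → 31/50` (provable now: the `2^{1/12}` pair-selection loss of
part XV replaced by `(11/10)^{1/12}`, same truncation radius `13/10`, same sharp tail) — and `stub_localHalfSpaceCert`
re-posed at separation `31/50` (weaker, hence more certifiable: competitor density `≤ 1/vol(B_{31/100}) ≈ 8.0` per unit
volume instead of `10.05`); `(CORE)` is derived from `sep_of_quarter_sharp` (landed), `stub_sepThirtyOne` and the new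
`(LOCAL)`; `stub_barlowChart` unchanged.  Registered radius kept at `6` pending the lead's free-exterior numerics
(job j027978 ff.; the disprover's `Negative/LocalRadius` kills radius `≤ 5/4`).
(Previous header, rev 5:)

Crux M* (UNIFORM BINDING IS RIGID), verbatim the route decl
`Summit.AtomisticToContinuum.Crystallization.Theses.PerronTransitivity.UniformBindingRigidity`:
a non-empty uniformly discrete `X ⊆ ℝ³` every site `p` of which has Lennard-Jones site energy
`U_X(p) = ∑'_{q ∈ X, q ≠ p} V_LJ(dist p q) ≤ 2E*`, `E* = ⨅_Q e_LJ(Q)` over periodic configurations,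
is the point set of a periodic configuration `P` with `IsLeast (range e_LJ) (e_LJ P)`.

Line `registered` (= `Lines/birth.lean`, the route's own TWO-LAYER PLAN
`UniformBindingRigidity ⇐ Cohesion → IsBarlow → (word lemma + registry domination + hcp least)`).
State after the lead's cycle 1 (2026-08-17, seat prover-line-stmt-AtomisticToContinuum-15099-c1):

* CLOSED `stub_periodicLeast` — LANDED as
  `Theorems.PerronTransitivityUniformBindingRigidity.stub_periodicLeast` (p143410, file
  `Theorems/PerronTransitivityUniformBindingRigidityPeriodicLeast.lean`): a periodic configuration all
  of whose sites are bound `≤ 2E*` is a least element (`e(P) ≤ E* ≤ e(Q)`).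
* CLOSED `stub_stackingLock` — LANDED as
  `Theorems.PerronTransitivityUniformBindingRigidity.stub_stackingLock` (p143502, file
  `…StackingLock.lean`): on a rigid image of `barlowStacking a h s`, `(a,h)` in item 3063's box, uniform
  `2E*`-binding forces `s (m+1) = -s m` (site sum `= 2·barlowSiteEnergy` by
  `PeriodicWindowsSketch.shp_site_tsum_eq`; `E* ≤ e(hcp a h) = hcpE a h`; word column
  `PalmGoodLaw.SiteColumnLJ.stub_siteColumnLJ`, deficit `½(J₃ − J₂) > 0` per cubic side).
* RESHAPED `stub_cohesion` → `stub_noThickHalfSpaceBinding`.  Seven helper files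
  `Theorems/PerronTransitivityUniformBindingRigidityCohesion{A,…,G}.lean` (p144796, p145083, p145435,
  p145724, p145450, p145733, p146119) prove: absolute separation `1/4` of uniformly bound sets
  (`quarter_le_dist`), `2E* ≤ −711/500` (`two_mul_iInf_le`), the finite surface-cluster form, passage of
  uniform site bounds to local limits, `cohesion ⇔ (NHB)` (no uniformly `2E*`-bound `1/4`-separated
  half-space configuration through `0`), NO uniformly bound SLAB (thin case, `noSlabBinding`), and finally
  `cohesion ⇔ (NHB-thick)` (`noThickHalfSpaceBinding_iff_cohesion`).  The registered stub is therefore now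
  the open core `(NHB-thick)` itself — a sitewise positive-surface-tension statement for a free flat surface
  of bulk Lennard-Jones matter (multi-site; the single-site plan of the card provably cannot reach the
  margin: `0.775`-separated half-space configurations bind one site below `2E*`).
* OPEN `stub_barlowChart` (XL, held by the lead) — a relatively dense, uniformly discrete, uniformly
  `2E*`-bound `X` is a rigid image of a Barlow stacking with `(a, h)` in the box: the tetrahedral-
  frustration / close-packing rigidity content of M* itself (Blanc–Lewin 2015 §2.3: open in `d = 3`);
  honestly crux-sized (lead verdict `promote-stub`, see `Lines/registered` notes / NOTES.md Census).

State after the lead's cycle 2 (2026-08-17, seat prover-line-stmt-AtomisticToContinuum-15099-c2), rev 3: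

* RESHAPED `stub_noThickHalfSpaceBinding` → `stub_halfSpaceCore`, the `e*`-FREE kernel-level core
  `(CORE_λ)` at `λ = 711/500`: no `1/4`-separated thick half-space configuration through `0` has ALL its
  Lennard-Jones site sums `≤ −711/500` (no `⨅` over periodic configurations occurs in it).  Wave 1 of c2
  landed four more helper files `…Cohesion{H,HSharp,I,J}.lean` (p150231, p150892, p149797, p149826):
  `(CORE_λ) ⇒ (NHB-thick)` for every admissible level `2e* ≤ −λ` (`noThickHalfSpaceBinding_of_core_at`,
  kernel instance `noThickHalfSpaceBinding_of_core_rung` at `711/500` from `two_mul_iInf_le`; certified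
  instance at `1435/1000` from the computational window `OnePercentFccWindow.eStar_le`, file `HSharp`),
  the single-site split/packing infrastructure (`neg_tsum_le_card_add_tail`, `card_near_le`,
  `card_le_half_of_separated`, `neg_tsum_top_le_half_packing_add_tail`, part I) and sequential compactness of
  the class of half-space-bound configurations under ball matching (`stub_nhb_limitClosed`, part J).
  `stub_noThickHalfSpaceBinding` is now DERIVED (`noThickHalfSpaceBinding_of_core_rung stub_halfSpaceCore`).
  Numerics of c2 (jobs j023956/j023958, half-space minimax at depth 0/1) inform the size of the core.
* OPEN `stub_barlowChart` unchanged (crux-sized; see LEAD-c2.md).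

Rev 5 (lead c2, cycle 3, after wave 2): `(SEP)` LANDED (p168661) and sharpened to `23/40` (parts L/M/N/O,
p169224 p169449 p169620 p169668, with the finite-certificate reduction part K p168970); the one open cohesion
stub is `stub_localHalfSpaceCert` at separation `23/40`, radius `6`; `(CORE)` derived by
`halfSpaceCore_of_localSharp`.  Open stubs: `stub_localHalfSpaceCert`, `stub_barlowChart`.

Rev 4 (lead c2, cycle 3): `stub_halfSpaceCore` RESHAPED into `stub_sepBootstrap` `(SEP)` — uniformly
`(−711/500)`-bound `1/4`-separated sets are `9/20`-separated (M, provable now) — and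
`stub_localHalfSpaceCert` `(LOCAL)` — in a `9/20`-separated half-space configuration through `0` some site
within distance `6` of `0` is bound `> −711/500` (finite-radius certificate, L/XL) — after the landed
`Negative/DepthZero(.Level)` (p168045, p168162) showed that at separation `1/4` no finite-radius certificate
around the top site can hold (radius `0` refuted in Lean; all radii by the cloud construction, LEAD-c2.md).

Composition (`UniformBindingRigidity_of`, real proof, no sorry): `(CORE)` gives `(NHB-thick)`, which gives cohesion
(`cohesion_of_noThickHalfSpaceBinding`, landed), cohesion feeds the chart; the landed lock makes `s`
2-periodic, so `P := ((barlowPeriodicConfiguration s ha hh 2 hs₂).isometryImage A).translate v` is a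
periodic configuration with `P.points = X`, and the landed `stub_periodicLeast` gives `IsLeast`.

Disproof used: none filed for this crux (`ledger crux ls`, 2026-08-17T07:30Z: no `Disproof.lean`); the
crux-attack refuter's `Theorems/UniformBindingRigidity/Negative/PeriodicCeiling.lean` (uniformly bound
periodic `P` ⇒ every motif site `= 2E*` exactly) and `LoadBearing.lean` (X = ∅ / singleton excluded and
load-bearing) kill no stub; its fault numerics (`|J₂| = 7.26e-5`) are the margin of the landed lock.
-/

noncomputable section

namespace Summit.AtomisticToContinuum.Crystallization.Cruxes.UniformBindingRigidity.Birth

open Literature.MathematicalPhysics.StatisticalMechanics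
open Summit.AtomisticToContinuum.Crystallization.Theses.PerronTransitivity (UniformBindingRigidity)

/-- **Thick or thin** (verbatim the landed `PerronTransitivityUniformBindingRigidity.noHalfSpaceBinding_of_thick`,
file `Theorems/…CohesionG.lean`, p146119; inlined here so that the skeleton elaborates against parts
I–VI alone): a half-space configuration is either thick (points at every depth) or contained in a slab,
and uniformly bound slabs do not exist (`noSlabBinding`, part VI). [folklore] -/
theorem noHalfSpaceBinding_of_thick
    (H : ∀ (Y : Set (EuclideanSpace ℝ (Fin 3))) (u : EuclideanSpace ℝ (Fin 3)), ‖u‖ = 1 →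
      (0 : EuclideanSpace ℝ (Fin 3)) ∈ Y →
      (∀ p ∈ Y, ∀ q ∈ Y, p ≠ q → 1 / 4 ≤ dist p q) →
      (∀ q ∈ Y, inner ℝ q u ≤ 0) →
      (∀ t : ℝ, ∃ q ∈ Y, inner ℝ q u < -t) →
      ∃ p ∈ Y, 2 * (⨅ Q : PeriodicConfiguration 3, Q.energyPerParticle lennardJones) <
        ∑' q : {q : EuclideanSpace ℝ (Fin 3) // q ∈ Y ∧ q ≠ p}, lennardJones (dist p q.1)) :
    ∀ (Y : Set (EuclideanSpace ℝ (Fin 3))) (u : EuclideanSpace ℝ (Fin 3)), ‖u‖ = 1 →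
      (0 : EuclideanSpace ℝ (Fin 3)) ∈ Y →
      (∀ p ∈ Y, ∀ q ∈ Y, p ≠ q → 1 / 4 ≤ dist p q) →
      (∀ q ∈ Y, inner ℝ q u ≤ 0) →
      ∃ p ∈ Y, 2 * (⨅ Q : PeriodicConfiguration 3, Q.energyPerParticle lennardJones) <
        ∑' q : {q : EuclideanSpace ℝ (Fin 3) // q ∈ Y ∧ q ≠ p}, lennardJones (dist p q.1) := by
  intro Y u hu h0 hsep hhalf
  by_cases hthick : ∀ t : ℝ, ∃ q ∈ Y, inner ℝ q u < -t
  · exact H Y u hu h0 hsep hhalf hthick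
  · push Not at hthick
    obtain ⟨t, ht⟩ := hthick
    exact Theorems.PerronTransitivityUniformBindingRigidity.noSlabBinding (T := t) hu h0 hsep
      fun q hq => ⟨ht q hq, hhalf q hq⟩

/-- **Cohesion from `(NHB-thick)`** (verbatim the landed
`PerronTransitivityUniformBindingRigidity.cohesion_of_noThickHalfSpaceBinding`, p146119; parts IV and
VI): if no THICK uniformly `2E*`-bound `1/4`-separated half-space configuration through `0` exists,
every non-empty uniformly discrete uniformly `2E*`-bound `X ⊆ ℝ³` is relatively dense. [folklore] -/
theorem cohesion_of_noThickHalfSpaceBinding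
    (H : ∀ (Y : Set (EuclideanSpace ℝ (Fin 3))) (u : EuclideanSpace ℝ (Fin 3)), ‖u‖ = 1 →
      (0 : EuclideanSpace ℝ (Fin 3)) ∈ Y →
      (∀ p ∈ Y, ∀ q ∈ Y, p ≠ q → 1 / 4 ≤ dist p q) →
      (∀ q ∈ Y, inner ℝ q u ≤ 0) →
      (∀ t : ℝ, ∃ q ∈ Y, inner ℝ q u < -t) →
      ∃ p ∈ Y, 2 * (⨅ Q : PeriodicConfiguration 3, Q.energyPerParticle lennardJones) <
        ∑' q : {q : EuclideanSpace ℝ (Fin 3) // q ∈ Y ∧ q ≠ p}, lennardJones (dist p q.1)) :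
    ∀ X : Set (EuclideanSpace ℝ (Fin 3)), X.Nonempty →
      (∃ δ : ℝ, 0 < δ ∧ ∀ p ∈ X, ∀ q ∈ X, p ≠ q → δ ≤ dist p q) →
      (∀ p ∈ X, ∑' q : {q : EuclideanSpace ℝ (Fin 3) // q ∈ X ∧ q ≠ p},
          lennardJones (dist p q.1) ≤
        2 * ⨅ Q : PeriodicConfiguration 3, Q.energyPerParticle lennardJones) →
      ∃ R : ℝ, ∀ y : EuclideanSpace ℝ (Fin 3), ∃ p ∈ X, dist y p ≤ R :=
  Theorems.PerronTransitivityUniformBindingRigidity.cohesion_of_noHalfSpaceBinding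
    (noHalfSpaceBinding_of_thick H)

/-- **SEPARATION BOOTSTRAP `(SEP)`** (stub of rev 4, LANDED by wave 2 of lead c2 as
`Theorems.PerronTransitivityUniformBindingRigidity.stub_sepBootstrap`, p168661, and SHARPENED by the same
wave to `23/40` — `sep_of_quarter_sharp`, part N p169620, via the sharp sixth-power tail of part L
p169224): every `1/4`-separated `Y ⊆ ℝ³` all of whose Lennard-Jones site sums are `≤ −711/500` is
`23/40`-separated. [folklore] -/
theorem sepSharp_of_quarter :
    ∀ Y : Set (EuclideanSpace ℝ (Fin 3)),
      (∀ p ∈ Y, ∀ q ∈ Y, p ≠ q → 1 / 4 ≤ dist p q) →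
      (∀ p ∈ Y, ∑' q : {q : EuclideanSpace ℝ (Fin 3) // q ∈ Y ∧ q ≠ p},
          lennardJones (dist p q.1) ≤ -(711 / 500)) →
      ∀ p ∈ Y, ∀ q ∈ Y, p ≠ q → 23 / 40 ≤ dist p q :=
  fun _ hsep hU => Theorems.PerronTransitivityUniformBindingRigidity.sep_of_quarter_sharp hsep hU

/-- **SEPARATION RUNG `31/50`** (stub `stub_sepThirtyOne` of rev 6, LANDED by wave 1 of lead c3 as
`Theorems.PerronTransitivityUniformBindingRigidity.stub_sepThirtyOne`, p173514, file `…CohesionP.lean`; pair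
selection `(11/10)^{1/12}`, truncation `13/10`, sharp tail, three sub-intervals with margins `7.6 / 2.1 / 1.5`):
a `23/40`-separated `Y ⊆ ℝ³` all of whose Lennard-Jones site sums are `≤ −711/500` is `31/50`-separated. [folklore] -/
theorem sepThirtyOne :
    ∀ Y : Set (EuclideanSpace ℝ (Fin 3)),
      (∀ p ∈ Y, ∀ q ∈ Y, p ≠ q → 23 / 40 ≤ dist p q) →
      (∀ p ∈ Y, ∑' q : {q : EuclideanSpace ℝ (Fin 3) // q ∈ Y ∧ q ≠ p},
          lennardJones (dist p q.1) ≤ -(711 / 500)) →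
      ∀ p ∈ Y, ∀ q ∈ Y, p ≠ q → 31 / 50 ≤ dist p q :=
  Theorems.PerronTransitivityUniformBindingRigidity.stub_sepThirtyOne

/-- **SEPARATION RUNG `16/25`** (stub `stub_sepSixteen` of rev 7, LANDED by wave 2 of lead c3 as
`Theorems.PerronTransitivityUniformBindingRigidity.stub_sepSixteen`, p174002, file `…CohesionS.lean`; credited
truncation of part XIX at `13/10`, pair selection `(11/10)^{1/12}`, three sub-intervals): a `31/50`-separated
`Y ⊆ ℝ³` all of whose Lennard-Jones site sums are `≤ −711/500` is `16/25`-separated. [folklore] -/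
theorem sepSixteen :
    ∀ Y : Set (EuclideanSpace ℝ (Fin 3)),
      (∀ p ∈ Y, ∀ q ∈ Y, p ≠ q → 31 / 50 ≤ dist p q) →
      (∀ p ∈ Y, ∑' q : {q : EuclideanSpace ℝ (Fin 3) // q ∈ Y ∧ q ≠ p},
          lennardJones (dist p q.1) ≤ -(711 / 500)) →
      ∀ p ∈ Y, ∀ q ∈ Y, p ≠ q → 16 / 25 ≤ dist p q :=
  Theorems.PerronTransitivityUniformBindingRigidity.stub_sepSixteen

/-- **stub 1 — LOCAL HALF-SPACE CERTIFICATE `(LOCAL)` at separation `16/25`** (rev 7, lead c3; rev 5/6 had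
`23/40` / `31/50`; size L/XL — a FINITE-RADIUS, `e*`-free, crystal-problem-free statement whose certification is a
computation: by the landed parametric reduction `stub_local_of_finiteCert_at` (part XVI, p169668) it follows from
the finite certificate `FINCERT(16/25, 6, −711/500, R')`: every finite `16/25`-separated `F ∋ 0` in the closed lower
half-space with `F ⊆ B̄(0, 6+R')` has a site `p`, `dist p 0 ≤ 6`, with
`Σ_{q ∈ F, q ≠ p, dist q p ≤ R'} V_LJ(dist p q) > −711/500 + (T(16/25,R') − (#near+1)R'⁻⁶)/6`, credited form
`local_of_finiteCert_credit_at`).  In every `16/25`-separated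
configuration `Y ∋ 0` contained in `{⟪·,u⟫ ≤ 0}` (`‖u‖ = 1`), some site within distance `6` of the top site `0`
has Lennard-Jones site sum `> −711/500`.  Why plausibly true: the top site of a free surface binds ≈ 1.0–1.15
against 1.422; over-binding it needs crowded shells whose own sites must be bound; the adversary's free resource is
the unconstrained exterior of the radius-`6` ball, whose influence is a boundary layer decaying inward.  Why it
might fail: an inward crowding cascade fed by a dense free exterior (then raise the radius); tightness in the
radius: `Negative/LocalRadius` (cdisprove) — false at radius `≤ 5/4` (hollow core, 104 points), hollow cores stop
near `1.4`; the lead's free-exterior adversary (jobs j027978 ff.) sizes the true radius. -/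
theorem stub_localHalfSpaceCert :
    ∀ (Y : Set (EuclideanSpace ℝ (Fin 3))) (u : EuclideanSpace ℝ (Fin 3)), ‖u‖ = 1 →
      (0 : EuclideanSpace ℝ (Fin 3)) ∈ Y →
      (∀ p ∈ Y, ∀ q ∈ Y, p ≠ q → 16 / 25 ≤ dist p q) →
      (∀ q ∈ Y, inner ℝ q u ≤ 0) →
      (∀ p ∈ Y, dist p 0 ≤ 6 → ∑' q : {q : EuclideanSpace ℝ (Fin 3) // q ∈ Y ∧ q ≠ p},
          lennardJones (dist p q.1) ≤ -(711 / 500)) →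
      False := by
  sorry

/-- **HALF-SPACE CORE `(CORE)`** (registered stub of rev 3 = the route-level child
`UniformBindingHalfSpaceCore` of the strategist's split, glue `Theorems/…Split.lean`; DERIVED since rev 4):
no `1/4`-separated thick half-space configuration through `0` has all its Lennard-Jones site sums
`≤ −711/500`.  Composition (rev 8): the landed bootstrap `sep_of_quarter_sixteen` (parts X/XV/XVII/XX,
p168661/p169620/p173514/p174002) upgrades the separation to `16/25`, and `(LOCAL)` at `16/25` finds an under-bound
site within distance `6` of `0` (thickness is not used). [folklore] -/
theorem halfSpaceCore :
    ∀ (Y : Set (EuclideanSpace ℝ (Fin 3))) (u : EuclideanSpace ℝ (Fin 3)), ‖u‖ = 1 →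
      (0 : EuclideanSpace ℝ (Fin 3)) ∈ Y →
      (∀ p ∈ Y, ∀ q ∈ Y, p ≠ q → 1 / 4 ≤ dist p q) →
      (∀ q ∈ Y, inner ℝ q u ≤ 0) →
      (∀ t : ℝ, ∃ q ∈ Y, inner ℝ q u < -t) →
      (∀ p ∈ Y, ∑' q : {q : EuclideanSpace ℝ (Fin 3) // q ∈ Y ∧ q ≠ p},
          lennardJones (dist p q.1) ≤ -(711 / 500)) →
      False :=
  fun Y u hu h0 hsep hhalf _ hU =>
    stub_localHalfSpaceCert Y u hu h0
      (Theorems.PerronTransitivityUniformBindingRigidity.sep_of_quarter_sixteen hsep hU)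
      hhalf fun p hp _ => hU p hp

/-- **NO THICK HALF-SPACE BINDING `(NHB-thick)`** (former registered stub `stub_noThickHalfSpaceBinding`,
now DERIVED from `halfSpaceCore` by the landed kernel-level reduction
`PerronTransitivityUniformBindingRigidity.noThickHalfSpaceBinding_of_core_rung`, part H, p150231): every
`1/4`-separated thick half-space configuration through `0` has a site with site sum `> 2e*`. [folklore] -/
theorem noThickHalfSpaceBinding :
    ∀ (Y : Set (EuclideanSpace ℝ (Fin 3))) (u : EuclideanSpace ℝ (Fin 3)), ‖u‖ = 1 →
      (0 : EuclideanSpace ℝ (Fin 3)) ∈ Y →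
      (∀ p ∈ Y, ∀ q ∈ Y, p ≠ q → 1 / 4 ≤ dist p q) →
      (∀ q ∈ Y, inner ℝ q u ≤ 0) →
      (∀ t : ℝ, ∃ q ∈ Y, inner ℝ q u < -t) →
      ∃ p ∈ Y, 2 * (⨅ Q : PeriodicConfiguration 3, Q.energyPerParticle lennardJones) <
        ∑' q : {q : EuclideanSpace ℝ (Fin 3) // q ∈ Y ∧ q ≠ p}, lennardJones (dist p q.1) :=
  Theorems.PerronTransitivityUniformBindingRigidity.noThickHalfSpaceBinding_of_core_rung halfSpaceCore

/-- **COHESION** (former `stub_cohesion`, now DERIVED): a non-empty, uniformly discrete, uniformly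
`2E*`-bound `X ⊆ ℝ³` is relatively dense — from `noThickHalfSpaceBinding` (i.e. from `stub_halfSpaceCore`) by the landed
`PerronTransitivityUniformBindingRigidity.cohesion_of_noThickHalfSpaceBinding` (parts I–VII of the
cohesion helpers: absolute separation, surface clusters, local limits, no slab binding). [folklore] -/
theorem cohesion :
    ∀ X : Set (EuclideanSpace ℝ (Fin 3)), X.Nonempty →
      (∃ δ : ℝ, 0 < δ ∧ ∀ p ∈ X, ∀ q ∈ X, p ≠ q → δ ≤ dist p q) →
      (∀ p ∈ X, ∑' q : {q : EuclideanSpace ℝ (Fin 3) // q ∈ X ∧ q ≠ p},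
          lennardJones (dist p q.1) ≤
        2 * ⨅ Q : PeriodicConfiguration 3, Q.energyPerParticle lennardJones) →
      ∃ R : ℝ, ∀ y : EuclideanSpace ℝ (Fin 3), ∃ p ∈ X, dist y p ≤ R :=
  cohesion_of_noThickHalfSpaceBinding noThickHalfSpaceBinding

/-- **stub 2 — BARLOW CHART** (route: `UniformBindingIsBarlow`; size XL, the HARDEST stub: the
tetrahedral-frustration step in minimax form). A relatively dense, uniformly discrete, uniformly
`2E*`-bound `X` is a rigid-motion image of a Barlow stacking `barlowStacking a h s` of some Hägg
sequence `s`, with in-layer spacing `a` and layer spacing `h` in the registry box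
`47/50 ≤ a ≤ 1`, `39a/50 ≤ h ≤ 17a/20` (the box of `LjRegistryDomination`, stmt-3063, which contains
the relaxed hcp optimum `a* ≈ 0.9712`, `h*/a* ≈ 0.8165`). Why it might fail: a uniformly super-bound
frustrated (Frank–Kasper / icosahedral) order — single sites reach `0.986` (σ) / `0.969` (A15) of the
hcp level; the bet is that no configuration has ALL sites at the crystal average except stackings.
Lead verdict (cycle 1): crux-sized — it contains (i) that `E*` is attained in the Barlow class with
`(a,h)` in the box (hcp-type global periodic minimality, open) and (ii) that no aperiodic / frustrated
uniformly discrete set is uniformly bound at the periodic level (the 3-D crystal problem in minimax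
form); no 2–3-stub reshape inside this line makes either piece session-sized. -/
theorem stub_barlowChart :
    ∀ X : Set (EuclideanSpace ℝ (Fin 3)), X.Nonempty →
      (∃ δ : ℝ, 0 < δ ∧ ∀ p ∈ X, ∀ q ∈ X, p ≠ q → δ ≤ dist p q) →
      (∀ p ∈ X, ∑' q : {q : EuclideanSpace ℝ (Fin 3) // q ∈ X ∧ q ≠ p},
          lennardJones (dist p q.1) ≤
        2 * ⨅ Q : PeriodicConfiguration 3, Q.energyPerParticle lennardJones) →
      (∃ R : ℝ, ∀ y : EuclideanSpace ℝ (Fin 3), ∃ p ∈ X, dist y p ≤ R) →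
      ∃ a h : ℝ, 47 / 50 ≤ a ∧ a ≤ 1 ∧ 39 / 50 * a ≤ h ∧ h ≤ 17 / 20 * a ∧
        ∃ s : ℤ → ℤ, IsHaggSeq s ∧
          ∃ (A : EuclideanSpace ℝ (Fin 3) ≃ₗᵢ[ℝ] EuclideanSpace ℝ (Fin 3))
            (v : EuclideanSpace ℝ (Fin 3)),
            X = (fun z => A z + v) '' barlowStacking a h s := by
  sorry

/-- **STACKING LOCK** (former `stub_stackingLock`, LANDED p143502 as
`Theorems.PerronTransitivityUniformBindingRigidity.stub_stackingLock`): on a rigid image of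
`barlowStacking a h s` with `(a, h)` in the box, uniform `2E*`-binding forces `s (m+1) = -s m`.
[folklore] -/
theorem stackingLock :
    ∀ (a h : ℝ) (s : ℤ → ℤ) (A : EuclideanSpace ℝ (Fin 3) ≃ₗᵢ[ℝ] EuclideanSpace ℝ (Fin 3))
      (v : EuclideanSpace ℝ (Fin 3)),
      47 / 50 ≤ a → a ≤ 1 → 39 / 50 * a ≤ h → h ≤ 17 / 20 * a → IsHaggSeq s →
      (∀ p ∈ (fun z => A z + v) '' barlowStacking a h s,
        ∑' q : {q : EuclideanSpace ℝ (Fin 3) //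
            q ∈ (fun z => A z + v) '' barlowStacking a h s ∧ q ≠ p},
          lennardJones (dist p q.1) ≤
        2 * ⨅ Q : PeriodicConfiguration 3, Q.energyPerParticle lennardJones) →
      ∀ m : ℤ, s (m + 1) = -s m :=
  Theorems.PerronTransitivityUniformBindingRigidity.stub_stackingLock

/-- **UNIFORMLY BOUND PERIODIC CONFIGURATIONS ARE GROUND STATES** (former `stub_periodicLeast`,
LANDED p143410 as `Theorems.PerronTransitivityUniformBindingRigidity.stub_periodicLeast`). [folklore] -/
theorem periodicLeast :
    ∀ P : PeriodicConfiguration 3,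
      (∀ p ∈ P.points, ∑' q : {q : EuclideanSpace ℝ (Fin 3) // q ∈ P.points ∧ q ≠ p},
          lennardJones (dist p q.1) ≤
        2 * ⨅ Q : PeriodicConfiguration 3, Q.energyPerParticle lennardJones) →
      IsLeast (Set.range fun Q : PeriodicConfiguration 3 => Q.energyPerParticle lennardJones)
        (P.energyPerParticle lennardJones) :=
  Theorems.PerronTransitivityUniformBindingRigidity.stub_periodicLeast

/-- **Composition** — the two open stubs imply the crux `UniformBindingRigidity` BY NAME (real proof,
no `sorry` in this declaration; the stubs enter by name): `(NHB-thick)` gives cohesion, cohesion feeds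
the Barlow chart (`stub_barlowChart`); the landed stacking lock makes the Hägg sequence `2`-periodic, so
the rigid image of the stacking is the point set of the periodic configuration
`((barlowPeriodicConfiguration s _ _ _ _).isometryImage A).translate v` (proved here); the uniform bound
transported to it gives `IsLeast` by the landed `periodicLeast`. -/
theorem UniformBindingRigidity_of : UniformBindingRigidity := by
  intro X hne hsep hU
  -- (NHB-thick) ⇒ cohesion, which feeds stub 2: `X` is a rigid image of a Barlow stacking, `(a, h)` in the box
  obtain ⟨a, h, ha1, ha2, hh1, hh2, s, hs, A, v, rfl⟩ :=
    stub_barlowChart X hne hsep hU (cohesion X hne hsep hU)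
  -- landed lock: the Hägg sequence alternates, hence is `2`-periodic
  have halt : ∀ m : ℤ, s (m + 1) = -s m := stackingLock a h s A v ha1 ha2 hh1 hh2 hs hU
  have hs2 : ∀ i : ℤ, s (i + 2) = s i := fun i => by
    rw [show i + 2 = i + 1 + 1 by ring, halt, halt, neg_neg]
  have ha0 : 0 < a := lt_of_lt_of_le (by norm_num) ha1
  have hh0 : 0 < h := lt_of_lt_of_le (by positivity) hh1
  -- the periodic configuration carrying `X`: rotate and translate the period-2 Barlow configuration
  have hP : (((barlowPeriodicConfiguration s ha0.ne' hh0.ne' two_ne_zero hs2).isometryImage A).translate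
      v).points = (fun z => A z + v) '' barlowStacking a h s := by
    ext z
    rw [PeriodicConfiguration.mem_points_translate, PeriodicConfiguration.mem_points_isometryImage,
      barlowPeriodicConfiguration_points, Set.mem_image]
    constructor
    · intro hz
      exact ⟨A.symm (z - v), hz, by simp⟩
    · rintro ⟨w, hw, rfl⟩
      simpa using hw
  -- landed least-element lemma: every site of that periodic configuration is bound `≤ 2E*`
  exact ⟨_, hP, periodicLeast _ (hP ▸ hU)⟩

/-- The same composition in arrow form, for the record: `(NHB-thick)`-sig → `stub_barlowChart`-sig →
the crux (unfolded), the lock and the least-element lemma being landed theorems. This is the GLUE a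
planner needs to split M* into the two children `UniformBindingCohesion := (NHB-thick)` and
`UniformBindingIsBarlow := stub_barlowChart` (route header, TWO-LAYER PLAN). -/
theorem uniformBindingRigidity_of_stubs
    (hNHB : ∀ (Y : Set (EuclideanSpace ℝ (Fin 3))) (u : EuclideanSpace ℝ (Fin 3)), ‖u‖ = 1 →
      (0 : EuclideanSpace ℝ (Fin 3)) ∈ Y →
      (∀ p ∈ Y, ∀ q ∈ Y, p ≠ q → 1 / 4 ≤ dist p q) →
      (∀ q ∈ Y, inner ℝ q u ≤ 0) →
      (∀ t : ℝ, ∃ q ∈ Y, inner ℝ q u < -t) →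
      ∃ p ∈ Y, 2 * (⨅ Q : PeriodicConfiguration 3, Q.energyPerParticle lennardJones) <
        ∑' q : {q : EuclideanSpace ℝ (Fin 3) // q ∈ Y ∧ q ≠ p}, lennardJones (dist p q.1))
    (hChart : ∀ X : Set (EuclideanSpace ℝ (Fin 3)), X.Nonempty →
      (∃ δ : ℝ, 0 < δ ∧ ∀ p ∈ X, ∀ q ∈ X, p ≠ q → δ ≤ dist p q) →
      (∀ p ∈ X, ∑' q : {q : EuclideanSpace ℝ (Fin 3) // q ∈ X ∧ q ≠ p},
          lennardJones (dist p q.1) ≤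
        2 * ⨅ Q : PeriodicConfiguration 3, Q.energyPerParticle lennardJones) →
      (∃ R : ℝ, ∀ y : EuclideanSpace ℝ (Fin 3), ∃ p ∈ X, dist y p ≤ R) →
      ∃ a h : ℝ, 47 / 50 ≤ a ∧ a ≤ 1 ∧ 39 / 50 * a ≤ h ∧ h ≤ 17 / 20 * a ∧
        ∃ s : ℤ → ℤ, IsHaggSeq s ∧
          ∃ (A : EuclideanSpace ℝ (Fin 3) ≃ₗᵢ[ℝ] EuclideanSpace ℝ (Fin 3))
            (v : EuclideanSpace ℝ (Fin 3)),
            X = (fun z => A z + v) '' barlowStacking a h s) :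
    ∀ X : Set (EuclideanSpace ℝ (Fin 3)), X.Nonempty →
      (∃ δ : ℝ, 0 < δ ∧ ∀ p ∈ X, ∀ q ∈ X, p ≠ q → δ ≤ dist p q) →
      (∀ p ∈ X, ∑' q : {q : EuclideanSpace ℝ (Fin 3) // q ∈ X ∧ q ≠ p},
          lennardJones (dist p q.1) ≤
        2 * ⨅ Q : PeriodicConfiguration 3, Q.energyPerParticle lennardJones) →
      ∃ P : PeriodicConfiguration 3, P.points = X ∧
        IsLeast (Set.range fun Q : PeriodicConfiguration 3 => Q.energyPerParticle lennardJones)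
          (P.energyPerParticle lennardJones) := by
  intro X hne hsep hU
  obtain ⟨a, h, ha1, ha2, hh1, hh2, s, hs, A, v, rfl⟩ :=
    hChart X hne hsep hU
      (cohesion_of_noThickHalfSpaceBinding hNHB X hne hsep hU)
  have halt : ∀ m : ℤ, s (m + 1) = -s m :=
    Theorems.PerronTransitivityUniformBindingRigidity.stub_stackingLock a h s A v ha1 ha2 hh1 hh2 hs hU
  have hs2 : ∀ i : ℤ, s (i + 2) = s i := fun i => by
    rw [show i + 2 = i + 1 + 1 by ring, halt, halt, neg_neg]
  have ha0 : 0 < a := lt_of_lt_of_le (by norm_num) ha1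
  have hh0 : 0 < h := lt_of_lt_of_le (by positivity) hh1
  have hP : (((barlowPeriodicConfiguration s ha0.ne' hh0.ne' two_ne_zero hs2).isometryImage A).translate
      v).points = (fun z => A z + v) '' barlowStacking a h s := by
    ext z
    rw [PeriodicConfiguration.mem_points_translate, PeriodicConfiguration.mem_points_isometryImage,
      barlowPeriodicConfiguration_points, Set.mem_image]
    constructor
    · intro hz
      exact ⟨A.symm (z - v), hz, by simp⟩
    · rintro ⟨w, hw, rfl⟩
      simpa using hw
  exact ⟨_, hP, Theorems.PerronTransitivityUniformBindingRigidity.stub_periodicLeast _ (hP ▸ hU)⟩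

/-- Consistency check: the arrow form applied to the two open stubs is (definitionally) a proof of
the crux — `UniformBindingRigidity` unfolds to the codomain of `uniformBindingRigidity_of_stubs`. -/
example : UniformBindingRigidity :=
  uniformBindingRigidity_of_stubs noThickHalfSpaceBinding stub_barlowChart

/- Rev-3 glue (recorded as a comment so that exactly one theorem concludes the crux by name): the
planner's split of M* may take the `e*`-free `(CORE)` at `711/500` as the cohesion child, since
`uniformBindingRigidity_of_stubs (noThickHalfSpaceBinding_of_core_rung hCORE) hChart` is a proof of the
crux from `hCORE : (CORE)` and `hChart : stub_barlowChart`-sig (both maps landed: part H p150231 and this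
file's `uniformBindingRigidity_of_stubs`). -/

end Summit.AtomisticToContinuum.Crystallization.Cruxes.UniformBindingRigidity.Birth

end
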